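import Literature.NumberTheory.Primality.AKSTheorem
import Literature.NumberTheory.Primality.AKSExistsR
import Literature.NumberTheory.Primality.AKSPolyArith
import HarnessLib

/-!
# The AKS primality test and its correctness (Agrawal–Kayal–Saxena 2004, Theorem 4.1)

The deterministic polynomial-time primality test of [AKS04, §4] as a Boolean function
`AKS.aksDecide : ℕ → Bool`, and **Theorem 4.1**: `aksDecide n = true ↔ n.Prime`
(`AKS.aksDecide_eq_true_iff`).

With `L = Nat.size n` (so `2 ^ (L-1) ≤ n < 2 ^ L`, the input length) and `R = rBound L = 2L⁵ + 8`
the steps are, in this order (a reordering of the paper's steps 1–5 that changes neither the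
output nor polynomiality, chosen so that every later step may assume `n` has no factor `≤ R`):

1. `n < 2`: COMPOSITE (not prime);
2. some `2 ≤ d ≤ R`, `d < n`, divides `n` (`HasFactorLe`): COMPOSITE — the paper's step 3;
3. `n ≤ R`: PRIME — the paper's step 4;
4. `n = a ^ b` with `b ≥ 2` (`IsPerfectPower`): COMPOSITE — the paper's step 1;
5. `r = leastR n L R`, the least `r ≥ 2` with `n ^ k mod r ≠ 1` for all `1 ≤ k ≤ L²`
   (it is `≤ R` by `exists_r_le'`, Lemma 4.3) — the paper's step 2 with `log² n ↦ L²`;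
6. PRIME iff `(X + a) ^ n = X ^ n + a (mod X ^ r - 1, n)` for all `1 ≤ a < r`
   (`congrTest`, `AKSPolyArith.lean`; written as `List.all` over `a < r` with `a = 0` exempt) — the paper's step 5 with `⌊√φ(r) log n⌋ ↦ r - 1`
   (more `a`'s than the paper; harmless, see `AKSTheorem.lean`).

Correctness: a prime passes (Lemma 4.2: `congrTest_of_prime`); conversely the congruences make
`n` a power of its least prime factor `p > R ≥ r` (`prime_power_of_congruences`, Lemmas 4.5–4.9,
with `(n, r) = 1` and `o_r(n) > L²` supplied by steps 2 and 5), and step 4 leaves `n = p`.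
The running-time analysis (Thm 5.1) is the business of the machine files
`Literature/Computability/QuantumComplexity/AKSMachine*.lean`, which realise exactly these steps.

## References

* [AKS04] M. Agrawal, N. Kayal, N. Saxena, *PRIMES is in P*, Ann. of Math. 160 (2004) 781–793,
  §4 (the algorithm, Thm 4.1, Lemmas 4.2, 4.3, 4.9) (held: `doi:10.4007/annals.2004.160.781`).
-/

namespace Literature.NumberTheory.Primality

open Polynomial Finset

namespace AKS

/-! ### The steps -/

/-- Step 3 of [AKS04] (trial division by small numbers): some `2 ≤ d ≤ R` with `d < n` divides
`n`. [cite: AgrawalKayalSaxena2004, §4 (step 3)] -/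
def HasFactorLe (n R : ℕ) : Prop :=
  ∃ d ∈ Icc 2 R, d < n ∧ d ∣ n

/-- `HasFactorLe` is decidable (bounded search). [folklore] -/
instance (n R : ℕ) : Decidable (HasFactorLe n R) := by
  unfold HasFactorLe; infer_instance

/-- Step 1 of [AKS04]: `n = a ^ b` for some `b ≥ 2` (bounded form, `a, b ≤ n`; see
`isPerfectPower_iff`). [cite: AgrawalKayalSaxena2004, §4 (step 1)] -/
def IsPerfectPower (n : ℕ) : Prop :=
  ∃ b ∈ Icc 2 n, ∃ a ∈ range (n + 1), a ^ b = n

/-- `IsPerfectPower` is decidable (bounded search). [folklore] -/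
instance (n : ℕ) : Decidable (IsPerfectPower n) := by
  unfold IsPerfectPower; infer_instance

/-- The order condition of step 2 of [AKS04] with `log² n ↦ L²`: `n ^ k mod r ≠ 1` for all
`1 ≤ k ≤ L ^ 2`. [cite: AgrawalKayalSaxena2004, §4 (step 2)] -/
def GoodR (n L r : ℕ) : Prop :=
  ∀ k ∈ Icc 1 (L ^ 2), n ^ k % r ≠ 1

/-- `GoodR` is decidable (bounded conjunction). [folklore] -/
instance (n L r : ℕ) : Decidable (GoodR n L r) := by
  unfold GoodR; infer_instance

/-- The search of step 2 terminates: `R + 1` is past the bound. [folklore] -/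
theorem leastR_exists (n L R : ℕ) : ∃ r, R < r ∨ (2 ≤ r ∧ GoodR n L r) :=
  ⟨R + 1, Or.inl (Nat.lt_succ_self R)⟩

/-- Step 2 of [AKS04]: the least `r ≥ 2` with `GoodR n L r`, the search being cut off after `R`
(value `R + 1` if no `r ≤ R` qualifies, which by Lemma 4.3 does not happen for `R = rBound L`).
[cite: AgrawalKayalSaxena2004, §4 (step 2)] -/
def leastR (n L R : ℕ) : ℕ :=
  Nat.find (leastR_exists n L R)

/-- **The AKS algorithm** [AKS04, §4] as a Boolean function (steps in the order 3, 4, 1, 2, 5 of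
the paper; `L = Nat.size n`, `R = rBound L`; see the module docstring).
[cite: AgrawalKayalSaxena2004, §4 (Algorithm for Primality Testing)] -/
def aksDecide (n : ℕ) : Bool :=
  if n < 2 then false
  else if HasFactorLe n (rBound n.size) then false
  else if n ≤ rBound n.size then true
  else if IsPerfectPower n then false
  else (List.range (leastR n n.size (rBound n.size))).all fun a =>
    a == 0 || congrTest n (leastR n n.size (rBound n.size)) a

/-! ### Properties of the steps -/

/-- `IsPerfectPower n` is the usual notion for `n ≥ 2`. [folklore] -/
theorem isPerfectPower_iff {n : ℕ} (hn : 2 ≤ n) :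
    IsPerfectPower n ↔ ∃ a b : ℕ, 2 ≤ b ∧ a ^ b = n := by
  constructor
  · rintro ⟨b, hb, a, -, hab⟩
    exact ⟨a, b, (mem_Icc.mp hb).1, hab⟩
  · rintro ⟨a, b, hb, hab⟩
    have ha : 2 ≤ a := by
      by_contra h
      interval_cases a
      · rw [zero_pow (by omega)] at hab; omega
      · rw [one_pow] at hab; omega
    have hbn : b ≤ n := by
      have h1 : b < 2 ^ b := Nat.lt_two_pow_self
      have h2 : 2 ^ b ≤ a ^ b := Nat.pow_le_pow_left ha b
      omega
    have han : a ≤ n := by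
      calc a = a ^ 1 := (pow_one a).symm
        _ ≤ a ^ b := Nat.pow_le_pow_right (by omega) (by omega)
        _ = n := hab
    exact ⟨b, mem_Icc.mpr ⟨hb, hbn⟩, a, mem_range.mpr (by omega), hab⟩

/-- A prime is not a perfect power. [folklore] -/
theorem not_isPerfectPower_of_prime {n : ℕ} (hn : n.Prime) : ¬IsPerfectPower n := by
  rw [isPerfectPower_iff hn.two_le]
  rintro ⟨a, b, hb, hab⟩
  have ha : a ∣ n := ⟨a ^ (b - 1), by rw [← pow_succ', Nat.sub_add_cancel (by omega), hab]⟩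
  rcases (Nat.dvd_prime hn).mp ha with rfl | rfl
  · rw [one_pow] at hab; exact hn.one_lt.ne hab
  · have : b = 1 := Nat.pow_right_injective hn.two_le (by simpa using hab)
    omega

/-- A prime power `p ^ k` that is `≥ 2` and not a perfect power is the prime itself
([AKS04, last sentence of the proof of Lemma 4.9]). [cite: AgrawalKayalSaxena2004, Lemma 4.9] -/
theorem eq_of_prime_pow_of_not_isPerfectPower {n p k : ℕ} (hn : 2 ≤ n)
    (hnp : n = p ^ k) (hpp : ¬IsPerfectPower n) : n = p := by
  rcases Nat.lt_trichotomy k 1 with hk | rfl | hk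
  · have : k = 0 := by omega
    subst this; simp at hnp; omega
  · simpa using hnp
  · exact absurd ((isPerfectPower_iff hn).mpr ⟨p, k, hk, hnp.symm⟩) hpp

/-- The value of step 2: `leastR n L R` is past `R`, or it is `≥ 2` and good. [folklore] -/
theorem leastR_spec (n L R : ℕ) :
    R < leastR n L R ∨ (2 ≤ leastR n L R ∧ GoodR n L (leastR n L R)) :=
  Nat.find_spec (leastR_exists n L R)

/-- Minimality of step 2: any good `r ≥ 2` bounds `leastR`. [folklore] -/
theorem leastR_le_of_goodR {n L R r : ℕ} (hr : 2 ≤ r) (hgood : GoodR n L r) : leastR n L R ≤ r :=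
  Nat.find_min' _ (Or.inr ⟨hr, hgood⟩)

/-- `2 ≤ leastR n L R` whenever `2 ≤ R`. [folklore] -/
theorem two_le_leastR (n L : ℕ) {R : ℕ} (hR : 2 ≤ R) : 2 ≤ leastR n L R := by
  rcases leastR_spec n L R with h | h
  · omega
  · exact h.1

/-- **Lemma 4.3 applied**: for `2 ≤ n < 2 ^ L`, `leastR n L (rBound L) ≤ rBound L` and it is good.
[cite: AgrawalKayalSaxena2004, Lemma 4.3] -/
theorem leastR_le_rBound {n L : ℕ} (hn : 2 ≤ n) (hnL : n < 2 ^ L) :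
    2 ≤ leastR n L (rBound L) ∧ leastR n L (rBound L) ≤ rBound L ∧
      GoodR n L (leastR n L (rBound L)) := by
  obtain ⟨r', hr'2, hr'R, hr'⟩ := exists_r_le' hn hnL
  have hgood : GoodR n L r' := fun k hk => hr' k (mem_Icc.mp hk).1 (mem_Icc.mp hk).2
  have hle := leastR_le_of_goodR (R := rBound L) hr'2 hgood
  rcases leastR_spec n L (rBound L) with h | h
  · omega
  · exact ⟨h.1, hle.trans hr'R, h.2⟩

/-- `2 ≤ rBound L`. [folklore] -/
theorem two_le_rBound (L : ℕ) : 2 ≤ rBound L := by unfold rBound; omega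

/-! ### Theorem 4.1 -/

/-- **[AKS04, Lemma 4.2]: primes pass.** [cite: AgrawalKayalSaxena2004, Lemma 4.2] -/
theorem aksDecide_of_prime {n : ℕ} (hn : n.Prime) : aksDecide n = true := by
  unfold aksDecide
  have h2 := hn.two_le
  split_ifs with h hfac hle hpp
  · omega
  · obtain ⟨d, hd, hdn, hdvd⟩ := hfac
    have hd2 := (mem_Icc.mp hd).1
    rcases (Nat.dvd_prime hn).mp hdvd with rfl | rfl <;> omega
  · rfl
  · exact absurd hpp (not_isPerfectPower_of_prime hn)
  · simp only [List.all_eq_true, Bool.or_eq_true, beq_iff_eq]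
    intro a _
    exact Or.inr (congrTest_of_prime hn (two_le_leastR n _ (two_le_rBound _)) a)

/-- **[AKS04, Lemma 4.9 / Theorem 4.1, hard direction]: if the algorithm returns PRIME then `n`
is prime.** [cite: AgrawalKayalSaxena2004, Lemma 4.9] -/
theorem prime_of_aksDecide {n : ℕ} (h : aksDecide n = true) : n.Prime := by
  unfold aksDecide at h
  split_ifs at h with h2 hfac hle hpp
  · -- `n ≤ R`: no divisor `2 ≤ d < n` at all
    rw [Nat.prime_def_lt']
    refine ⟨by omega, fun m hm2 hmn hmdvd => hfac ⟨m, mem_Icc.mpr ⟨hm2, by omega⟩, hmn, hmdvd⟩⟩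
  · -- the main case
    set L := n.size with hL
    set R := rBound L with hR
    have hn : 2 ≤ n := by omega
    have hnL : n < 2 ^ L := Nat.lt_size_self n
    obtain ⟨hr2, hrR, hgood⟩ := leastR_le_rBound hn hnL
    set r := leastR n L R with hr
    simp only [List.all_eq_true, List.mem_range, Bool.or_eq_true, beq_iff_eq] at h
    -- the least prime factor `p > R`
    set p := n.minFac with hp'
    have hp : p.Prime := Nat.minFac_prime (by omega)
    have hpn : p ∣ n := Nat.minFac_dvd n
    have hpR : R < p := by
      by_contra hle'
      refine hfac ⟨p, mem_Icc.mpr ⟨hp.two_le, not_lt.mp hle'⟩, ?_, hpn⟩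
      exact lt_of_le_of_lt (not_lt.mp hle') (not_le.mp hle)
    -- `(n, r) = 1`
    have hcop : n.Coprime r := by
      rw [Nat.Coprime]
      by_contra hg
      have hg0 : n.gcd r ≠ 0 := Nat.gcd_ne_zero_right (by omega)
      have hgr : n.gcd r ≤ r := Nat.gcd_le_right _ (by omega)
      refine hfac ⟨n.gcd r, mem_Icc.mpr ⟨by omega, by omega⟩, ?_, Nat.gcd_dvd_left n r⟩
      calc n.gcd r ≤ r := hgr
        _ ≤ R := hrR
        _ < n := not_le.mp hle
    -- `o_r(n) > L²`
    have hord : ∀ k, 0 < k → k ≤ L ^ 2 → ((n : ZMod r) ^ k ≠ 1) := by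
      intro k hk0 hkL heq
      refine hgood k (mem_Icc.mpr ⟨hk0, hkL⟩) ?_
      have h1 : ((n ^ k : ℕ) : ZMod r) = ((1 : ℕ) : ZMod r) := by rw [Nat.cast_pow, heq, Nat.cast_one]
      have := (ZMod.natCast_eq_natCast_iff' _ _ r).mp h1
      rwa [Nat.mod_eq_of_lt (show 1 < r by omega)] at this
    -- the congruences, `0 ≤ a < r`
    have hcong : ∀ a, a < r →
        (X ^ r - 1 : (ZMod n)[X]) ∣ (X + C (a : ZMod n)) ^ n - (X ^ n + C (a : ZMod n)) := by
      intro a ha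
      rcases Nat.eq_zero_or_pos a with rfl | ha0
      · simp
      · exact (congrTest_eq_true_iff hn hr2 a).mp ((h a ha).resolve_left (by omega))
    obtain ⟨k, hk⟩ := prime_power_of_congruences hp hpn hn hnL (by omega) (lt_of_le_of_lt hrR hpR)
      hcop hord hcong
    rw [eq_of_prime_pow_of_not_isPerfectPower hn hk hpp]
    exact hp

/-- **[AKS04, Theorem 4.1]: the algorithm returns PRIME if and only if `n` is prime.**
[cite: AgrawalKayalSaxena2004, Theorem 4.1] -/
theorem aksDecide_eq_true_iff (n : ℕ) : aksDecide n = true ↔ n.Prime :=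
  ⟨prime_of_aksDecide, aksDecide_of_prime⟩

end AKS

end Literature.NumberTheory.Primality
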